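import Summits.HodgeConjecture.HodgeConjecture.Theorems.F0P3cStCharTSEllInnerSlotCoords      -- ★ FILE B (this seat): `exists_swapEquiv`, coordinates, §0 field facts at a non-split place
import Summits.HodgeConjecture.HodgeConjecture.Theorems.F0P3cStCharTSUpTrCartanFields    -- ★ (H3b) `isClosed_cartan`
import Literature.NumberTheory.Automorphic.OrbitalMeasureCanonicalAtPoint                  -- ★ `eq_of_apply_compactCore_eq_one`; brings ★ `image_compactCore`
import HarnessLib

/-!
# F0 · P3c · ROAD «ELL-INNER» (E2b) «SLOT-AUT», FILE C — THE SLOT MAPS OF THE ELLIPTIC CARTAN SUBGROUPS OF `H_v = U(Φ₂)(L⁺_v) × U(Φ₁)(L⁺_v)`: the ∃-package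
# `exists_slotMaps` consumed by (E8) «ELL-INNER ASSEMBLY» (`cQ σ hσm hσreg hσR`), (E2) «FIBRE-ENUM» (`hG hN hD hR`) and (E0)∕(E4′) [Rogawski1990 §3.6 L. 3.6.1, §3.7 Prop. 3.7.1, §12.5 pp. 184–185]

Cell `pub/hodgecm-mathlib`, crux H413 = `stmt-HodgeConjecture-24833` (lane `--supports … --as helper`), route HCCMUnconditional; ROAD «ELL-INNER» (map owner LH6-p03 (g7) «=»
2026-09-02T20:26:20Z; desk F0P3-plan (g18) GO 20:08:17Z; LEAD T14-44); brick (E2b), FILE C of the census `F0/P3a/F0P3a-p03/g27/e2b/CENSUS-E2b-SlotAut.v1.F0P3ap03g27.md`;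
seat F0P3a-p03 (g27).  THEOREMS ONLY (no definition ∕ instance ∕ notation ∕ named fact ∕ `sorry`); ★-only imports.

WHAT.  `v` a finite place of `L⁺` NON-SPLIT in `L`; `SH` a finite set of COMPACT Cartan subgroups `T = Z_H(γ₀)` (`γ₀` `G`-regular) of `H_v` ((H1)∕(E8) letters `hZ`, `hKH`).
* §1 `isUnit_sub_of_separable` (`(X − a)(X − b)` separable ⇒ `a − b` a unit), `trace_det_charpoly_of_isRoot` (a root `a` of `χ_m` gives `tr m = a + a′`, `det m = a a′`,
  `χ_m = (X − a)(X − a′)`), `measurePreserving_of_continuousMulEquiv` (a continuous automorphism of a torus preserves every Haar measure of mass one on the compact core — ★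
  `image_compactCore` + ★ `eq_of_apply_compactCore_eq_one`; no compactness used), `not_isRoot_of_typeTwo` (TYPE (2): if `χ_g` has no root in `R` then neither has `χ_{t.1}` for any
  `G`-regular `t ∈ Z_H(γ₀)` — the structure identity of ★ FILE A applied to `g` against the spectral idempotent of `t.1`).
* §2 **`exists_slots`** — for ONE compact Cartan `T = Z_H(γ₀)`: `∃ k (e : Fin k → (↥T ≃ₜ* ↥T))` with (X) `charpoly ι(e_u t) = charpoly ι(t)`, (D) pairwise distinct `U(Φ₁)`-coordinates of the
  `e_u t` at `G`-regular `t`, (R) those coordinates are EXACTLY the roots of `charpoly ι(t)` in `R` — TYPE (1) (`χ_g` has a root): `k = 3`, `e = (refl, σ₁, σ₂)` from ★ FILE B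
  `exists_swapEquiv` at the spectral idempotents `P₁ = δ⁻¹(g − a₂)`, `P₂ = 1 − P₁`; TYPE (2): `k = 1`, `e = (refl)`.
* §3 **`exists_slotMaps`** — the PACKAGE over `SH`: `∃ (cQ : Subgroup H_v → ℕ) (σ : (T : Subgroup H_v) → Fin (cQ T) → (↥T → ↥T))` with (C) each `σ T u` underlies a `≃ₜ*`, (M) each `σ T u` preserves every
  Haar measure on `↥T` of mass one on the compact core (= ★ (E8)'s `hσm` at `(tH T, htHh, htH)`), (X) `charpoly ι` is preserved, (G) `G`-regularity is preserved (= (E8)'s `hσreg`),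
  (N′) norm pairs are preserved at `G`-regular points (⇒ (E8)'s `hσR`), (D) distinct `U(Φ₁)`-slots, (R) the slots ENUMERATE the rational eigenvalues (⇒ (E2)'s `hσpair`∕`hσexh`, (E0)'s `hcQ`,
  (E4′)'s frame), (K) `cQ T = 1 ∨ cQ T = 3` (TYPE (2) ∕ TYPE (1)); letters (G)(D)(R) = ★ (E2) `F0P3cStCharTSEllInnerFibreEnum.hcQ_of_slotClauses`'s `hG hD hR` token for token,
  (N′) = its ED. 2 `hN` (with the `G`-regularity antecedent).
HONEST LABEL: count-neutral; `𝔇.Prop1252` stays a PRINTED consequent of `hBlock′` until a ★ rider; HC_CM is proved only modulo the printed citations until rung 0 closes.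

## References
* [Rogawski1990] J. D. Rogawski, *Automorphic Representations of Unitary Groups in Three Variables*, Ann. of Math. Stud. 123 (1990): §3.6 pp. 28–31 (types of tori of `U(2)`; Lemma 3.6.1),
  §3.7 Prop. 3.7.1 p. 31 (`Ω_F(T, G) ∕ Ω_F(T, H)`), §12.5 pp. 184–185 (the slots `w ∈ Ω_F(T,G)∖Ω_F(T,H)` and the change of variables `γ ↦ wγw⁻¹` in the proof of Prop. 12.5.2).
* [DeitmarEchterhoff2014] A. Deitmar, S. Echterhoff, *Principles of Harmonic Analysis*, 2nd ed. (2014): Thm. 1.5.3 (uniqueness of Haar measure).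
-/

set_option autoImplicit false
-- the mandated namespace has the single-problem summit's repeated segment (`HodgeConjecture.HodgeConjecture`)
set_option linter.dupNamespace false

noncomputable section

open Matrix Polynomial NumberField IsDedekindDomain Topology MeasureTheory Measure
open Literature.NumberTheory.Automorphic Literature.NumberTheory.Automorphic.UnitaryGroup Literature.NumberTheory.Rogawski1990
open Summit.HodgeConjecture.HodgeConjecture.Cruxes.H413.F0P3cStCharTSEllInnerSlotAlgebra
open Summit.HodgeConjecture.HodgeConjecture.Cruxes.H413.F0P3cStCharTSEllInnerSlotCoords

namespace Summit.HodgeConjecture.HodgeConjecture.Cruxes.H413.F0P3cStCharTSEllInnerSlotMaps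

variable (L : Type) [Field L] [NumberField L] [IsCMField L] (v : HeightOneSpectrum (𝓞 ↥(maximalRealSubfield L)))

/-! ## §1 Helpers -/

omit [IsCMField L] in
/-- `(X − a)(X − b)` separable ⇒ `a − b` is a unit (evaluate a Bézout relation at `a`). [folklore] -/
theorem isUnit_sub_of_separable {a b : UnitaryGroup.LocalRing L v} (h : ((X - C a) * (X - C b)).Separable) : IsUnit (a - b) := by
  obtain ⟨p, q, hpq⟩ := h.isCoprime
  have he := congrArg (Polynomial.eval a) hpq
  simp only [eval_add, eval_mul, eval_sub, eval_X, eval_C, sub_self, mul_zero, zero_add, eval_one] at he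
  exact isUnit_iff_exists_inv.2 ⟨q.eval a, by rw [mul_comm]; exact he⟩

omit [IsCMField L] in
/-- A root `a` of `χ_m` (`m ∈ M₂`): `tr m = a + a′`, `det m = a a′`, `χ_m = (X − a)(X − a′)` with `a′ := tr m − a`. [folklore] -/
theorem trace_det_charpoly_of_isRoot (m : Matrix (Fin 2) (Fin 2) (UnitaryGroup.LocalRing L v)) {a : UnitaryGroup.LocalRing L v} (ha : m.charpoly.IsRoot a) :
    m.trace = a + (m.trace - a) ∧ m.det = a * (m.trace - a) ∧ m.charpoly = (X - C a) * (X - C (m.trace - a)) := by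
  haveI : Nontrivial (UnitaryGroup.LocalRing L v) := UnitaryGroup.nontrivial_localRing L v
  rw [Matrix.charpoly_fin_two, IsRoot] at ha
  simp only [eval_add, eval_sub, eval_mul, eval_pow, eval_X, eval_C] at ha
  have hdet : m.det = a * (m.trace - a) := by linear_combination ha
  refine ⟨by ring, hdet, ?_⟩
  rw [Matrix.charpoly_fin_two, hdet, map_mul, map_sub]
  ring

omit [Field L] [NumberField L] [IsCMField L] in
/-- Three values read at `0, 1, 2` that are pairwise distinct give an injective `Fin 3`-family (bookkeeping for clause (D)). [folklore] -/
theorem fin3_pairwise_ne {S : Type*} {f : Fin 3 → S} {c α β : S} (h0 : f 0 = c) (h1 : f 1 = α) (h2 : f 2 = β) (hαβ : α ≠ β) (hαc : α ≠ c) (hβc : β ≠ c) :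
    ∀ u u' : Fin 3, u ≠ u' → f u ≠ f u' := by
  intro u u' huu'
  fin_cases u <;> fin_cases u' <;> simp only [Fin.zero_eta, Fin.mk_one, Fin.isValue, Fin.reduceFinMk] at huu' ⊢
  · exact absurd rfl huu'
  · rw [h0, h1]; exact hαc.symm
  · rw [h0, h2]; exact hβc.symm
  · rw [h1, h0]; exact hαc
  · exact absurd rfl huu'
  · rw [h1, h2]; exact hαβ
  · rw [h2, h0]; exact hβc
  · rw [h2, h1]; exact hαβ.symm
  · exact absurd rfl huu'

omit [Field L] [NumberField L] [IsCMField L] in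
/-- `(∃ u : Fin 3, f u = r) ↔ f 0 = r ∨ f 1 = r ∨ f 2 = r` (bookkeeping for clause (R)). [folklore] -/
theorem fin3_exists_iff {S : Type*} (f : Fin 3 → S) (r : S) : (∃ u, f u = r) ↔ f 0 = r ∨ f 1 = r ∨ f 2 = r := by
  constructor
  · rintro ⟨u, hu⟩
    fin_cases u <;> simp only [Fin.zero_eta, Fin.mk_one, Fin.isValue, Fin.reduceFinMk] at hu
    · exact Or.inl hu
    · exact Or.inr (Or.inl hu)
    · exact Or.inr (Or.inr hu)
  · rintro (h | h | h)
    · exact ⟨0, h⟩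
    · exact ⟨1, h⟩
    · exact ⟨2, h⟩

/-- **A continuous automorphism of a torus preserves every Haar measure normalised on the compact core** (`μ ∘ e⁻¹` is Haar with the same normalisation — ★ `image_compactCore` —
hence equals `μ`, ★ `eq_of_apply_compactCore_eq_one`). [cite: DeitmarEchterhoff2014, Thm. 1.5.3] [cite: Rogawski1990, §12.5 p. 184] -/
theorem measurePreserving_of_continuousMulEquiv {K : Type*} [Group K] [TopologicalSpace K] [IsTopologicalGroup K] [LocallyCompactSpace K] [SecondCountableTopology K]
    [MeasurableSpace K] [BorelSpace K] (e : K ≃ₜ* K) (μ : Measure K) [μ.IsHaarMeasure] (hμ : μ (compactCore K) = 1) : MeasurePreserving e μ μ := by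
  refine ⟨e.continuous.measurable, ?_⟩
  have hme : MeasurableEmbedding e := e.toHomeomorph.measurableEmbedding
  have hmap : (μ.map e) (compactCore K) = 1 := by
    rw [hme.map_apply]
    conv_lhs => rw [← image_compactCore e]
    rw [Set.preimage_image_eq _ e.injective, hμ]
  exact eq_of_apply_compactCore_eq_one _ _ hmap hμ

section CM

variable {L v}

/-- **TYPE (2) IS STABLE ALONG THE TORUS**: if `χ_g` (`g = γ₀.1`) has no root in `R`, then for every `G`-regular `t ∈ T = Z_H(γ₀)` neither has `χ_{t.1}` — a root `r` of `χ_{t.1}` would make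
the spectral idempotent `P_t = (r − r′)⁻¹ (t.1 − r′)` available (`r − r′` a unit by `G`-regularity); `g` commutes with `t.1`, hence with `P_t`, so `g = x P_t + y (1 − P_t)` (★ FILE A
structure) and `χ_g = (X − x)(X − y)` would have the root `x`. [cite: Rogawski1990, §3.6 pp. 28–31] -/
theorem not_isRoot_of_typeTwo {γ₀ : (UnitaryGroup.cmDatum L 2 (Matrix.of fun i j : Fin 2 => if i.val + j.val + 1 = 2 then (1 : L) else 0)).Local v × (UnitaryGroup.cmDatum L 1 (Matrix.of fun i j : Fin 1 => if i.val + j.val + 1 = 1 then (1 : L) else 0)).Local v} (hno : ∀ a : UnitaryGroup.LocalRing L v, ¬ (finCharpolyTwo L v γ₀).IsRoot a) {T : Subgroup ((UnitaryGroup.cmDatum L 2 (Matrix.of fun i j : Fin 2 => if i.val + j.val + 1 = 2 then (1 : L) else 0)).Local v × (UnitaryGroup.cmDatum L 1 (Matrix.of fun i j : Fin 1 => if i.val + j.val + 1 = 1 then (1 : L) else 0)).Local v)}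
    (hT : T = Subgroup.centralizer ({γ₀} : Set ((UnitaryGroup.cmDatum L 2 (Matrix.of fun i j : Fin 2 => if i.val + j.val + 1 = 2 then (1 : L) else 0)).Local v × (UnitaryGroup.cmDatum L 1 (Matrix.of fun i j : Fin 1 => if i.val + j.val + 1 = 1 then (1 : L) else 0)).Local v))) (t : ↥T) (ht : IsLocalGRegular L v (t : (UnitaryGroup.cmDatum L 2 (Matrix.of fun i j : Fin 2 => if i.val + j.val + 1 = 2 then (1 : L) else 0)).Local v × (UnitaryGroup.cmDatum L 1 (Matrix.of fun i j : Fin 1 => if i.val + j.val + 1 = 1 then (1 : L) else 0)).Local v)) (r : UnitaryGroup.LocalRing L v) : ¬ (finCharpolyTwo L v (t : (UnitaryGroup.cmDatum L 2 (Matrix.of fun i j : Fin 2 => if i.val + j.val + 1 = 2 then (1 : L) else 0)).Local v × (UnitaryGroup.cmDatum L 1 (Matrix.of fun i j : Fin 1 => if i.val + j.val + 1 = 1 then (1 : L) else 0)).Local v)).IsRoot r := by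
  haveI : Nontrivial (UnitaryGroup.LocalRing L v) := UnitaryGroup.nontrivial_localRing L v
  intro hr
  obtain ⟨htr, hdet, hfac⟩ := trace_det_charpoly_of_isRoot L v (((t : (UnitaryGroup.cmDatum L 2 (Matrix.of fun i j : Fin 2 => if i.val + j.val + 1 = 2 then (1 : L) else 0)).Local v × (UnitaryGroup.cmDatum L 1 (Matrix.of fun i j : Fin 1 => if i.val + j.val + 1 = 1 then (1 : L) else 0)).Local v).1.val : GL (Fin 2) (UnitaryGroup.LocalRing L v)).val) hr
  have hsep : (finCharpolyTwo L v (t : (UnitaryGroup.cmDatum L 2 (Matrix.of fun i j : Fin 2 => if i.val + j.val + 1 = 2 then (1 : L) else 0)).Local v × (UnitaryGroup.cmDatum L 1 (Matrix.of fun i j : Fin 1 => if i.val + j.val + 1 = 1 then (1 : L) else 0)).Local v)).Separable := ht.separable_finCharpolyTwo L v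
  have hδ : IsUnit (r - ((((t : (UnitaryGroup.cmDatum L 2 (Matrix.of fun i j : Fin 2 => if i.val + j.val + 1 = 2 then (1 : L) else 0)).Local v × (UnitaryGroup.cmDatum L 1 (Matrix.of fun i j : Fin 1 => if i.val + j.val + 1 = 1 then (1 : L) else 0)).Local v).1.val : GL (Fin 2) (UnitaryGroup.LocalRing L v)).val).trace - r)) := by
    apply isUnit_sub_of_separable L v
    rw [← hfac]; exact hsep
  set δ := hδ.unit with hδdef
  have hδ' : (δ : UnitaryGroup.LocalRing L v) = r - ((((t : (UnitaryGroup.cmDatum L 2 (Matrix.of fun i j : Fin 2 => if i.val + j.val + 1 = 2 then (1 : L) else 0)).Local v × (UnitaryGroup.cmDatum L 1 (Matrix.of fun i j : Fin 1 => if i.val + j.val + 1 = 1 then (1 : L) else 0)).Local v).1.val : GL (Fin 2) (UnitaryGroup.LocalRing L v)).val).trace - r) := hδ.unit_spec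
  -- the spectral idempotent of `t.1`
  have hP := spectralIdem_mul_self δ htr hdet hδ'
  have htrP := trace_spectralIdem δ htr hδ'
  -- `g` commutes with `t.1`, hence with `P_t`
  have hcomm := val_fst_mul_comm_of_mem hT t
  have hgP := commute_spectralIdem_of_commute (a₂ := (((t : (UnitaryGroup.cmDatum L 2 (Matrix.of fun i j : Fin 2 => if i.val + j.val + 1 = 2 then (1 : L) else 0)).Local v × (UnitaryGroup.cmDatum L 1 (Matrix.of fun i j : Fin 1 => if i.val + j.val + 1 = 1 then (1 : L) else 0)).Local v).1.val : GL (Fin 2) (UnitaryGroup.LocalRing L v)).val).trace - r) δ hcomm.symm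
  have hg := eq_trace_smul_add_trace_smul_of_commute hP htrP hgP
  set Pt : Matrix (Fin 2) (Fin 2) (UnitaryGroup.LocalRing L v) := (↑δ⁻¹ : UnitaryGroup.LocalRing L v) • ((((t : (UnitaryGroup.cmDatum L 2 (Matrix.of fun i j : Fin 2 => if i.val + j.val + 1 = 2 then (1 : L) else 0)).Local v × (UnitaryGroup.cmDatum L 1 (Matrix.of fun i j : Fin 1 => if i.val + j.val + 1 = 1 then (1 : L) else 0)).Local v).1.val : GL (Fin 2) (UnitaryGroup.LocalRing L v)).val) - ((((t : (UnitaryGroup.cmDatum L 2 (Matrix.of fun i j : Fin 2 => if i.val + j.val + 1 = 2 then (1 : L) else 0)).Local v × (UnitaryGroup.cmDatum L 1 (Matrix.of fun i j : Fin 1 => if i.val + j.val + 1 = 1 then (1 : L) else 0)).Local v).1.val : GL (Fin 2) (UnitaryGroup.LocalRing L v)).val).trace - r) • (1 : Matrix (Fin 2) (Fin 2) (UnitaryGroup.LocalRing L v))) with hPtdef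
  set g : Matrix (Fin 2) (Fin 2) (UnitaryGroup.LocalRing L v) := (γ₀.1.val : GL (Fin 2) (UnitaryGroup.LocalRing L v)).val with hgdef
  have hχ : g.charpoly = (X - C (Pt * g).trace) * (X - C ((1 - Pt) * g).trace) := by
    conv_lhs => rw [hg]
    exact charpoly_smul_add_smul hP htrP _ _
  refine hno (Pt * g).trace ?_
  show (g.charpoly).IsRoot _
  rw [hχ, IsRoot, eval_mul, eval_sub, eval_X, eval_C, sub_self, zero_mul]

/-! ## §2 The slots of ONE compact Cartan subgroup -/

set_option maxHeartbeats 1600000 in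
-- the type-(1) branch builds two swap automorphisms and checks nine index cases on the CM carriers
/-- **THE SLOTS OF A COMPACT CARTAN SUBGROUP `T = Z_H(γ₀)`** (`γ₀` `G`-regular, `v` non-split): finitely many continuous automorphisms `e_u : ↥T ≃ₜ* ↥T` (`k = 3`: `refl` and the
two swaps of ★ FILE B at the spectral idempotents of a TYPE-(1) `g`; `k = 1`: `refl` for TYPE (2)) such that (X) `charpoly ι(e_u t) = charpoly ι(t)`, (D) at a `G`-regular `t` the
`U(Φ₁)`-coordinates `finGammaTwo (e_u t)` are pairwise distinct, and (R) they are exactly the roots of `charpoly ι(t)` in `R = ∏_{w ∣ v} L_w`.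
[cite: Rogawski1990, §3.7 Prop. 3.7.1 p. 31; §3.6 Lemma 3.6.1 p. 31; §12.5 pp. 184–185] -/
theorem exists_slots (hns : ∀ w : PlacesOver L v, IsCMField.complexConj L • w.1 = w.1) {γ₀ : (UnitaryGroup.cmDatum L 2 (Matrix.of fun i j : Fin 2 => if i.val + j.val + 1 = 2 then (1 : L) else 0)).Local v × (UnitaryGroup.cmDatum L 1 (Matrix.of fun i j : Fin 1 => if i.val + j.val + 1 = 1 then (1 : L) else 0)).Local v} (hγ₀ : IsLocalGRegular L v γ₀)
    {T : Subgroup ((UnitaryGroup.cmDatum L 2 (Matrix.of fun i j : Fin 2 => if i.val + j.val + 1 = 2 then (1 : L) else 0)).Local v × (UnitaryGroup.cmDatum L 1 (Matrix.of fun i j : Fin 1 => if i.val + j.val + 1 = 1 then (1 : L) else 0)).Local v)} (hT : T = Subgroup.centralizer ({γ₀} : Set ((UnitaryGroup.cmDatum L 2 (Matrix.of fun i j : Fin 2 => if i.val + j.val + 1 = 2 then (1 : L) else 0)).Local v × (UnitaryGroup.cmDatum L 1 (Matrix.of fun i j : Fin 1 => if i.val + j.val + 1 = 1 then (1 : L)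 else 0)).Local v))) (hcpt : IsCompact (T : Set ((UnitaryGroup.cmDatum L 2 (Matrix.of fun i j : Fin 2 => if i.val + j.val + 1 = 2 then (1 : L) else 0)).Local v × (UnitaryGroup.cmDatum L 1 (Matrix.of fun i j : Fin 1 => if i.val + j.val + 1 = 1 then (1 : L) else 0)).Local v))) :
    ∃ (k : ℕ) (e : Fin k → (↥T ≃ₜ* ↥T)), (k = 1 ∨ k = 3) ∧
      (∀ (u : Fin k) (s : ↥T), ((endoEmbLocal L v ((e u s : ↥T) : (UnitaryGroup.cmDatum L 2 (Matrix.of fun i j : Fin 2 => if i.val + j.val + 1 = 2 then (1 : L) else 0)).Local v × (UnitaryGroup.cmDatum L 1 (Matrix.of fun i j : Fin 1 => if i.val + j.val + 1 = 1 then (1 : L) else 0)).Local v)).val.val : Matrix (Fin 3) (Fin 3) (UnitaryGroup.LocalRing L v)).charpoly =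
        ((endoEmbLocal L v (s : (UnitaryGroup.cmDatum L 2 (Matrix.of fun i j : Fin 2 => if i.val + j.val + 1 = 2 then (1 : L) else 0)).Local v × (UnitaryGroup.cmDatum L 1 (Matrix.of fun i j : Fin 1 => if i.val + j.val + 1 = 1 then (1 : L) else 0)).Local v)).val.val : Matrix (Fin 3) (Fin 3) (UnitaryGroup.LocalRing L v)).charpoly) ∧
      (∀ s : ↥T, IsLocalGRegular L v (s : (UnitaryGroup.cmDatum L 2 (Matrix.of fun i j : Fin 2 => if i.val + j.val + 1 = 2 then (1 : L) else 0)).Local v × (UnitaryGroup.cmDatum L 1 (Matrix.of fun i j : Fin 1 => if i.val + j.val + 1 = 1 then (1 : L) else 0)).Local v) → ∀ u u' : Fin k, u ≠ u' → finGammaTwo L v ((e u s : ↥T) : (UnitaryGroup.cmDatum L 2 (Matrix.of fun i j : Fin 2 => if i.val + j.val + 1 = 2 then (1 : L) else 0)).Local v × (UnitaryGroup.cmDatum L 1 (Matrix.of fun i j : Fin 1 => if i.val + j.val + 1 = 1 then (1 : L) else 0)).Local v) ≠ finGammaTwo L v ((e u' s : ↥T) : (UnitaryGroup.cmDatum L 2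 (Matrix.of fun i j : Fin 2 => if i.val + j.val + 1 = 2 then (1 : L) else 0)).Local v × (UnitaryGroup.cmDatum L 1 (Matrix.of fun i j : Fin 1 => if i.val + j.val + 1 = 1 then (1 : L) else 0)).Local v)) ∧
      (∀ s : ↥T, IsLocalGRegular L v (s : (UnitaryGroup.cmDatum L 2 (Matrix.of fun i j : Fin 2 => if i.val + j.val + 1 = 2 then (1 : L) else 0)).Local v × (UnitaryGroup.cmDatum L 1 (Matrix.of fun i j : Fin 1 => if i.val + j.val + 1 = 1 then (1 : L) else 0)).Local v) → ∀ r : UnitaryGroup.LocalRing L v,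
        (((endoEmbLocal L v (s : (UnitaryGroup.cmDatum L 2 (Matrix.of fun i j : Fin 2 => if i.val + j.val + 1 = 2 then (1 : L) else 0)).Local v × (UnitaryGroup.cmDatum L 1 (Matrix.of fun i j : Fin 1 => if i.val + j.val + 1 = 1 then (1 : L) else 0)).Local v)).val.val : Matrix (Fin 3) (Fin 3) (UnitaryGroup.LocalRing L v)).charpoly).IsRoot r ↔ ∃ u : Fin k, finGammaTwo L v ((e u s : ↥T) : (UnitaryGroup.cmDatum L 2 (Matrix.of fun i j : Fin 2 => if i.val + j.val + 1 = 2 then (1 : L) else 0)).Local v × (UnitaryGroup.cmDatum L 1 (Matrix.of fun i j : Fin 1 => if i.val + j.val + 1 = 1 then (1 : L) else 0)).Local v) = r) := by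
  haveI : Nontrivial (UnitaryGroup.LocalRing L v) := UnitaryGroup.nontrivial_localRing L v
  by_cases hroot : ∃ a₁ : UnitaryGroup.LocalRing L v, (finCharpolyTwo L v γ₀).IsRoot a₁
  · -- TYPE (1)
    obtain ⟨a₁, ha₁⟩ := hroot
    obtain ⟨htr, hdet, hfac⟩ := trace_det_charpoly_of_isRoot L v ((γ₀.1.val : GL (Fin 2) (UnitaryGroup.LocalRing L v)).val) ha₁
    set g : Matrix (Fin 2) (Fin 2) (UnitaryGroup.LocalRing L v) := (γ₀.1.val : GL (Fin 2) (UnitaryGroup.LocalRing L v)).val with hgdef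
    set a₂ : UnitaryGroup.LocalRing L v := g.trace - a₁ with ha₂def
    have hsepg : g.charpoly.Separable := hγ₀.separable_finCharpolyTwo L v
    have hδu : IsUnit (a₁ - a₂) := isUnit_sub_of_separable L v (by rw [← hfac]; exact hsepg)
    set δ := hδu.unit with hδdef
    have hδ' : (δ : UnitaryGroup.LocalRing L v) = a₁ - a₂ := hδu.unit_spec
    -- roots are norm-one (compactness)
    have ha₁u : a₁ * UnitaryGroup.conjLocal L (IsCMField.complexConj L) v a₁ = 1 := mul_conjLocal_eq_one_of_isRoot hns hγ₀ hT hcpt ha₁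
    have ha₂root : (finCharpolyTwo L v γ₀).IsRoot a₂ := by
      show (g.charpoly).IsRoot a₂
      rw [hfac, IsRoot, eval_mul, eval_sub, eval_sub, eval_X, eval_C, eval_C, sub_self, mul_zero]
    have ha₂u : a₂ * UnitaryGroup.conjLocal L (IsCMField.complexConj L) v a₂ = 1 := mul_conjLocal_eq_one_of_isRoot hns hγ₀ hT hcpt ha₂root
    -- the spectral idempotent `P` and its complement
    set P : Matrix (Fin 2) (Fin 2) (UnitaryGroup.LocalRing L v) := (↑δ⁻¹ : UnitaryGroup.LocalRing L v) • (g - a₂ • (1 : Matrix (Fin 2) (Fin 2) (UnitaryGroup.LocalRing L v))) with hPdef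
    have hP : P * P = P := spectralIdem_mul_self δ htr hdet hδ'
    have htrP : P.trace = 1 := trace_spectralIdem δ htr hδ'
    have hgu : (g.map (UnitaryGroup.conjLocal L (IsCMField.complexConj L) v))ᵀ * UnitaryGroup.cmLocalForm L 2 v * g = UnitaryGroup.cmLocalForm L 2 v := mem_unitaryGroupOfForm_iff.1 γ₀.1.2
    have hadj : (P.map (UnitaryGroup.conjLocal L (IsCMField.complexConj L) v))ᵀ * UnitaryGroup.cmLocalForm L 2 v = UnitaryGroup.cmLocalForm L 2 v * P := transpose_map_spectralIdem_mul_eq (UnitaryGroup.conjLocal L (IsCMField.complexConj L) v) (UnitaryGroup.cmLocalForm L 2 v) δ hδ' hP hgu ha₁u ha₂u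
    have hPc : ∀ m : Matrix (Fin 2) (Fin 2) (UnitaryGroup.LocalRing L v), m * g = g * m → m * P = P * m := fun m hm => commute_spectralIdem_of_commute δ hm
    have hPg : P * g = g * P := (commute_spectralIdem_of_commute (a₂ := a₂) δ (rfl : g * g = g * g)).symm
    have hP' : (1 - P) * (1 - P) = 1 - P := one_sub_idem_mul_self hP
    have htrP' : (1 - P).trace = 1 := trace_one_sub_idem htrP
    have hadj' : ((1 - P).map (UnitaryGroup.conjLocal L (IsCMField.complexConj L) v))ᵀ * UnitaryGroup.cmLocalForm L 2 v = UnitaryGroup.cmLocalForm L 2 v * (1 - P) := transpose_map_one_sub_mul_eq (UnitaryGroup.conjLocal L (IsCMField.complexConj L) v) (UnitaryGroup.cmLocalForm L 2 v) hadj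
    have hPc' : ∀ m : Matrix (Fin 2) (Fin 2) (UnitaryGroup.LocalRing L v), m * g = g * m → m * (1 - P) = (1 - P) * m := fun m hm => by
      rw [mul_sub, sub_mul, mul_one, one_mul, hPc m hm]
    have hPg' : (1 - P) * g = g * (1 - P) := by rw [mul_sub, sub_mul, mul_one, one_mul, hPg]
    obtain ⟨e₁, he₁⟩ := exists_swapEquiv hT hP htrP hadj hPc hPg
    obtain ⟨e₂, he₂⟩ := exists_swapEquiv hT hP' htrP' hadj' hPc' hPg'
    -- coordinates
    have hcoords := fun s : ↥T => charpoly_endoEmbLocal_eq_prod hT hP htrP hPc s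
    have hX₁ : ∀ s : ↥T, ((endoEmbLocal L v ((e₁ s : ↥T) : (UnitaryGroup.cmDatum L 2 (Matrix.of fun i j : Fin 2 => if i.val + j.val + 1 = 2 then (1 : L) else 0)).Local v × (UnitaryGroup.cmDatum L 1 (Matrix.of fun i j : Fin 1 => if i.val + j.val + 1 = 1 then (1 : L) else 0)).Local v)).val.val : Matrix (Fin 3) (Fin 3) (UnitaryGroup.LocalRing L v)).charpoly =
        ((endoEmbLocal L v (s : (UnitaryGroup.cmDatum L 2 (Matrix.of fun i j : Fin 2 => if i.val + j.val + 1 = 2 then (1 : L) else 0)).Local v × (UnitaryGroup.cmDatum L 1 (Matrix.of fun i j : Fin 1 => if i.val + j.val + 1 = 1 then (1 : L) else 0)).Local v)).val.val : Matrix (Fin 3) (Fin 3) (UnitaryGroup.LocalRing L v)).charpoly := by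
      intro s
      rw [hcoords s, charpoly_endoEmbLocal]
      unfold finCharpolyTwo
      rw [(he₁ s).1, (he₁ s).2, charpoly_smul_add_smul hP htrP]
      ring
    have hX₂ : ∀ s : ↥T, ((endoEmbLocal L v ((e₂ s : ↥T) : (UnitaryGroup.cmDatum L 2 (Matrix.of fun i j : Fin 2 => if i.val + j.val + 1 = 2 then (1 : L) else 0)).Local v × (UnitaryGroup.cmDatum L 1 (Matrix.of fun i j : Fin 1 => if i.val + j.val + 1 = 1 then (1 : L) else 0)).Local v)).val.val : Matrix (Fin 3) (Fin 3) (UnitaryGroup.LocalRing L v)).charpoly =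
        ((endoEmbLocal L v (s : (UnitaryGroup.cmDatum L 2 (Matrix.of fun i j : Fin 2 => if i.val + j.val + 1 = 2 then (1 : L) else 0)).Local v × (UnitaryGroup.cmDatum L 1 (Matrix.of fun i j : Fin 1 => if i.val + j.val + 1 = 1 then (1 : L) else 0)).Local v)).val.val : Matrix (Fin 3) (Fin 3) (UnitaryGroup.LocalRing L v)).charpoly := by
      intro s
      rw [hcoords s, charpoly_endoEmbLocal]
      unfold finCharpolyTwo
      rw [(he₂ s).1, (he₂ s).2, charpoly_smul_add_smul hP' htrP', sub_sub_cancel]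
      ring
    have hγ₁ : ∀ s : ↥T, finGammaTwo L v ((e₁ s : ↥T) : (UnitaryGroup.cmDatum L 2 (Matrix.of fun i j : Fin 2 => if i.val + j.val + 1 = 2 then (1 : L) else 0)).Local v × (UnitaryGroup.cmDatum L 1 (Matrix.of fun i j : Fin 1 => if i.val + j.val + 1 = 1 then (1 : L) else 0)).Local v) = (P * ((s : (UnitaryGroup.cmDatum L 2 (Matrix.of fun i j : Fin 2 => if i.val + j.val + 1 = 2 then (1 : L) else 0)).Local v × (UnitaryGroup.cmDatum L 1 (Matrix.of fun i j : Fin 1 => if i.val + j.val + 1 = 1 then (1 : L) else 0)).Local v).1.val : GL (Fin 2) (UnitaryGroup.LocalRing L v)).val).trace := fun s => (he₁ s).2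
    have hγ₂ : ∀ s : ↥T, finGammaTwo L v ((e₂ s : ↥T) : (UnitaryGroup.cmDatum L 2 (Matrix.of fun i j : Fin 2 => if i.val + j.val + 1 = 2 then (1 : L) else 0)).Local v × (UnitaryGroup.cmDatum L 1 (Matrix.of fun i j : Fin 1 => if i.val + j.val + 1 = 1 then (1 : L) else 0)).Local v) = ((1 - P) * ((s : (UnitaryGroup.cmDatum L 2 (Matrix.of fun i j : Fin 2 => if i.val + j.val + 1 = 2 then (1 : L) else 0)).Local v × (UnitaryGroup.cmDatum L 1 (Matrix.of fun i j : Fin 1 => if i.val + j.val + 1 = 1 then (1 : L) else 0)).Local v).1.val : GL (Fin 2) (UnitaryGroup.LocalRing L v)).val).trace := fun s => (he₂ s).2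
    refine ⟨3, ![ContinuousMulEquiv.refl _, e₁, e₂], Or.inr rfl, ?_, ?_, ?_⟩
    · intro u s
      fin_cases u
      · rfl
      · exact hX₁ s
      · exact hX₂ s
    · -- distinct slots at a `G`-regular `s`: the three coordinates of a separable `(X − α)(X − β)(X − u)`
      intro s hs u u' huu'
      have hsep : (((endoEmbLocal L v (s : (UnitaryGroup.cmDatum L 2 (Matrix.of fun i j : Fin 2 => if i.val + j.val + 1 = 2 then (1 : L) else 0)).Local v × (UnitaryGroup.cmDatum L 1 (Matrix.of fun i j : Fin 1 => if i.val + j.val + 1 = 1 then (1 : L) else 0)).Local v)).val.val : Matrix (Fin 3) (Fin 3) (UnitaryGroup.LocalRing L v)).charpoly).Separable := hs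
      rw [hcoords s] at hsep
      set α := (P * ((s : (UnitaryGroup.cmDatum L 2 (Matrix.of fun i j : Fin 2 => if i.val + j.val + 1 = 2 then (1 : L) else 0)).Local v × (UnitaryGroup.cmDatum L 1 (Matrix.of fun i j : Fin 1 => if i.val + j.val + 1 = 1 then (1 : L) else 0)).Local v).1.val : GL (Fin 2) (UnitaryGroup.LocalRing L v)).val).trace
      set β := ((1 - P) * ((s : (UnitaryGroup.cmDatum L 2 (Matrix.of fun i j : Fin 2 => if i.val + j.val + 1 = 2 then (1 : L) else 0)).Local v × (UnitaryGroup.cmDatum L 1 (Matrix.of fun i j : Fin 1 => if i.val + j.val + 1 = 1 then (1 : L) else 0)).Local v).1.val : GL (Fin 2) (UnitaryGroup.LocalRing L v)).val).trace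
      set c := finGammaTwo L v (s : (UnitaryGroup.cmDatum L 2 (Matrix.of fun i j : Fin 2 => if i.val + j.val + 1 = 2 then (1 : L) else 0)).Local v × (UnitaryGroup.cmDatum L 1 (Matrix.of fun i j : Fin 1 => if i.val + j.val + 1 = 1 then (1 : L) else 0)).Local v)
      have hαβ : α ≠ β := fun h => not_separable_X_sub_C_sq_mul L v β (X - C c) (by rw [h] at hsep; exact hsep)
      have hαc : α ≠ c := fun h =>
        not_separable_X_sub_C_sq_mul L v c (X - C β) (by rw [h] at hsep; rw [show (X - C c) * (X - C c) * (X - C β) = (X - C c) * (X - C β) * (X - C c) by ring]; exact hsep)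
      have hβc : β ≠ c := fun h =>
        not_separable_X_sub_C_sq_mul L v c (X - C α) (by rw [h] at hsep; rw [show (X - C c) * (X - C c) * (X - C α) = (X - C α) * (X - C c) * (X - C c) by ring]; exact hsep)
      have h0 : finGammaTwo L v (((![ContinuousMulEquiv.refl _, e₁, e₂] : Fin 3 → (↥T ≃ₜ* ↥T)) 0 s : ↥T) : (UnitaryGroup.cmDatum L 2 (Matrix.of fun i j : Fin 2 => if i.val + j.val + 1 = 2 then (1 : L) else 0)).Local v × (UnitaryGroup.cmDatum L 1 (Matrix.of fun i j : Fin 1 => if i.val + j.val + 1 = 1 then (1 : L) else 0)).Local v) = c := rfl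
      have h1 : finGammaTwo L v (((![ContinuousMulEquiv.refl _, e₁, e₂] : Fin 3 → (↥T ≃ₜ* ↥T)) 1 s : ↥T) : (UnitaryGroup.cmDatum L 2 (Matrix.of fun i j : Fin 2 => if i.val + j.val + 1 = 2 then (1 : L) else 0)).Local v × (UnitaryGroup.cmDatum L 1 (Matrix.of fun i j : Fin 1 => if i.val + j.val + 1 = 1 then (1 : L) else 0)).Local v) = α := hγ₁ s
      have h2 : finGammaTwo L v (((![ContinuousMulEquiv.refl _, e₁, e₂] : Fin 3 → (↥T ≃ₜ* ↥T)) 2 s : ↥T) : (UnitaryGroup.cmDatum L 2 (Matrix.of fun i j : Fin 2 => if i.val + j.val + 1 = 2 then (1 : L) else 0)).Local v × (UnitaryGroup.cmDatum L 1 (Matrix.of fun i j : Fin 1 => if i.val + j.val + 1 = 1 then (1 : L) else 0)).Local v) = β := hγ₂ s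
      exact fin3_pairwise_ne (f := fun u => finGammaTwo L v (((![ContinuousMulEquiv.refl _, e₁, e₂] : Fin 3 → (↥T ≃ₜ* ↥T)) u s : ↥T) : (UnitaryGroup.cmDatum L 2 (Matrix.of fun i j : Fin 2 => if i.val + j.val + 1 = 2 then (1 : L) else 0)).Local v × (UnitaryGroup.cmDatum L 1 (Matrix.of fun i j : Fin 1 => if i.val + j.val + 1 = 1 then (1 : L) else 0)).Local v)) h0 h1 h2 hαβ hαc hβc u u' huu'
    · -- the slots enumerate the roots
      intro s _ r
      rw [hcoords s, isRoot_mul_X_sub_C_iff L v hns, isRoot_X_sub_C_mul_X_sub_C_iff L v hns,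
        fin3_exists_iff (fun u => finGammaTwo L v (((![ContinuousMulEquiv.refl _, e₁, e₂] : Fin 3 → (↥T ≃ₜ* ↥T)) u s : ↥T) : (UnitaryGroup.cmDatum L 2 (Matrix.of fun i j : Fin 2 => if i.val + j.val + 1 = 2 then (1 : L) else 0)).Local v × (UnitaryGroup.cmDatum L 1 (Matrix.of fun i j : Fin 1 => if i.val + j.val + 1 = 1 then (1 : L) else 0)).Local v)) r]
      refine ⟨?_, ?_⟩
      · rintro ((h | h) | h)
        · exact Or.inr (Or.inl ((hγ₁ s).trans h.symm))
        · exact Or.inr (Or.inr ((hγ₂ s).trans h.symm))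
        · exact Or.inl h.symm
      · rintro (h | h | h)
        · exact Or.inr (Eq.symm h)
        · exact Or.inl (Or.inl (((hγ₁ s).symm.trans h).symm))
        · exact Or.inl (Or.inr (((hγ₂ s).symm.trans h).symm))
  · -- TYPE (2)
    push Not at hroot
    refine ⟨1, ![ContinuousMulEquiv.refl _], Or.inl rfl, fun u s => by fin_cases u; rfl, fun s _ u u' huu' => absurd (Subsingleton.elim u u') huu', fun s hs r => ?_⟩
    rw [charpoly_endoEmbLocal, isRoot_mul_X_sub_C_iff L v hns]
    constructor
    · rintro (h | h)
      · exact absurd h (not_isRoot_of_typeTwo hroot hT s hs r)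
      · exact ⟨0, h.symm⟩
    · rintro ⟨u, hu⟩
      fin_cases u
      exact Or.inr hu.symm

/-! ## §3 The package over a family of compact Cartan subgroups -/

/-- **(E2b) «SLOT-AUT» — THE SLOT MAPS OF THE ELLIPTIC CARTAN SUBGROUPS, as consumed by (E8)∕(E2)∕(E0)∕(E4′).**  For a finite set `SH` of compact Cartan subgroups `T = Z_H(γ₀)` (`γ₀`
`G`-regular) of `H_v` (`v` non-split) there are `cQ : Subgroup H_v → ℕ` and `σ : (T : Subgroup H_v) → Fin (cQ T) → (↥T → ↥T)` such that, for every `T ∈ SH` and `u : Fin (cQ T)`: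
(C) `σ T u` underlies a continuous group automorphism `↥T ≃ₜ* ↥T` (never an `H_v`-conjugation); (M) `σ T u` preserves EVERY Haar measure `μ` on `↥T` with `μ(compactCore) = 1`
(★ (E8)'s `hσm` at `tH T`); (X) `charpoly ι_v` is invariant under `σ T u`; (G) `G`-regularity is preserved ((E8)'s `hσreg`); (N′) at `G`-regular `s`, every norm partner of `s` is a
norm partner of `σ T u s` (⇒ (E8)'s `hσR`); (D) at `G`-regular `s` the `U(Φ₁)`-slots `finGammaTwo (σ T u s)` are pairwise distinct in `u`; (R) they are exactly the roots of
`charpoly ι_v(s)` in `∏_{w ∣ v} L_w` (⇒ `cQ T` = 3 for TYPE (1), 1 for TYPE (2); (E2)'s transversal, (E0)'s `hcQ`).  Letters (G)(D)(R) = ★ (E2) `hcQ_of_slotClauses` token for token.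
[cite: Rogawski1990, §3.7 Prop. 3.7.1 p. 31; §3.6 Lemma 3.6.1 p. 31; §12.5 pp. 184–185] [cite: DeitmarEchterhoff2014, Thm. 1.5.3] -/
theorem exists_slotMaps (hns : ∀ w : PlacesOver L v, IsCMField.complexConj L • w.1 = w.1)
    [MeasurableSpace ((UnitaryGroup.cmDatum L 2 (Matrix.of fun i j : Fin 2 => if i.val + j.val + 1 = 2 then (1 : L) else 0)).Local v × (UnitaryGroup.cmDatum L 1 (Matrix.of fun i j : Fin 1 => if i.val + j.val + 1 = 1 then (1 : L) else 0)).Local v)] [BorelSpace ((UnitaryGroup.cmDatum L 2 (Matrix.of fun i j : Fin 2 => if i.val + j.val + 1 = 2 then (1 : L) else 0)).Local v × (UnitaryGroup.cmDatum L 1 (Matrix.of fun i j : Fin 1 => if i.val + j.val + 1 = 1 then (1 : L) else 0)).Local v)]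
    (SH : Finset (Subgroup ((UnitaryGroup.cmDatum L 2 (Matrix.of fun i j : Fin 2 => if i.val + j.val + 1 = 2 then (1 : L) else 0)).Local v × (UnitaryGroup.cmDatum L 1 (Matrix.of fun i j : Fin 1 => if i.val + j.val + 1 = 1 then (1 : L) else 0)).Local v)))
    (hZ : ∀ T ∈ SH, ∃ γ₀ : (UnitaryGroup.cmDatum L 2 (Matrix.of fun i j : Fin 2 => if i.val + j.val + 1 = 2 then (1 : L) else 0)).Local v × (UnitaryGroup.cmDatum L 1 (Matrix.of fun i j : Fin 1 => if i.val + j.val + 1 = 1 then (1 : L) else 0)).Local v, IsLocalGRegular L v γ₀ ∧ T = Subgroup.centralizer ({γ₀} : Set ((UnitaryGroup.cmDatum L 2 (Matrix.of fun i j : Fin 2 => if i.val + j.val + 1 = 2 then (1 : L) else 0)).Local v × (UnitaryGroup.cmDatum L 1 (Matrix.of fun i j : Fin 1 => if i.val + j.val + 1 = 1 then (1 : L) else 0)).Local v)))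
    (hKH : ∀ T ∈ SH, IsCompact (T : Set ((UnitaryGroup.cmDatum L 2 (Matrix.of fun i j : Fin 2 => if i.val + j.val + 1 = 2 then (1 : L) else 0)).Local v × (UnitaryGroup.cmDatum L 1 (Matrix.of fun i j : Fin 1 => if i.val + j.val + 1 = 1 then (1 : L) else 0)).Local v))) :
    ∃ (cQ : Subgroup ((UnitaryGroup.cmDatum L 2 (Matrix.of fun i j : Fin 2 => if i.val + j.val + 1 = 2 then (1 : L) else 0)).Local v × (UnitaryGroup.cmDatum L 1 (Matrix.of fun i j : Fin 1 => if i.val + j.val + 1 = 1 then (1 : L) else 0)).Local v) → ℕ) (σ : (T : Subgroup ((UnitaryGroup.cmDatum L 2 (Matrix.of fun i j : Fin 2 => if i.val + j.val + 1 = 2 then (1 : L) else 0)).Local v × (UnitaryGroup.cmDatum L 1 (Matrix.of fun i j : Fin 1 => if i.val + j.val + 1 = 1 then (1 : L) else 0)).Local v)) → Fin (cQ T) → (↥T → ↥T)),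
      (∀ T ∈ SH, ∀ u : Fin (cQ T), ∃ e : ↥T ≃ₜ* ↥T, ⇑e = σ T u) ∧
      (∀ T ∈ SH, ∀ (u : Fin (cQ T)) (μ : Measure ↥T), μ.IsHaarMeasure → μ (compactCore ↥T) = 1 → MeasurePreserving (σ T u) μ μ) ∧
      (∀ T ∈ SH, ∀ (u : Fin (cQ T)) (s : ↥T), ((endoEmbLocal L v (σ T u s).1).val.val : Matrix (Fin 3) (Fin 3) (UnitaryGroup.LocalRing L v)).charpoly =
        ((endoEmbLocal L v s.1).val.val : Matrix (Fin 3) (Fin 3) (UnitaryGroup.LocalRing L v)).charpoly) ∧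
      (∀ T ∈ SH, ∀ (u : Fin (cQ T)) (s : ↥T), IsLocalGRegular L v (s : ((UnitaryGroup.cmDatum L 2 (Matrix.of fun i j : Fin 2 => if i.val + j.val + 1 = 2 then (1 : L) else 0)).Local v × (UnitaryGroup.cmDatum L 1 (Matrix.of fun i j : Fin 1 => if i.val + j.val + 1 = 1 then (1 : L) else 0)).Local v)) → IsLocalGRegular L v (σ T u s : ((UnitaryGroup.cmDatum L 2 (Matrix.of fun i j : Fin 2 => if i.val + j.val + 1 = 2 then (1 : L) else 0)).Local v × (UnitaryGroup.cmDatum L 1 (Matrix.of fun i j : Fin 1 => if i.val + j.val + 1 = 1 then (1 : L) else 0)).Local v))) ∧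
      (∀ T ∈ SH, ∀ (u : Fin (cQ T)) (s : ↥T), IsLocalGRegular L v (s : ((UnitaryGroup.cmDatum L 2 (Matrix.of fun i j : Fin 2 => if i.val + j.val + 1 = 2 then (1 : L) else 0)).Local v × (UnitaryGroup.cmDatum L 1 (Matrix.of fun i j : Fin 1 => if i.val + j.val + 1 = 1 then (1 : L) else 0)).Local v)) → ∀ γ : Gqs L v, IsLocalNormPair L (qsForm L) v s.1 γ → IsLocalNormPair L (qsForm L) v (σ T u s).1 γ) ∧
      (∀ T ∈ SH, ∀ (s : ↥T), IsLocalGRegular L v (s : ((UnitaryGroup.cmDatum L 2 (Matrix.of fun i j : Fin 2 => if i.val + j.val + 1 = 2 then (1 : L) else 0)).Local v × (UnitaryGroup.cmDatum L 1 (Matrix.of fun i j : Fin 1 => if i.val + j.val + 1 = 1 then (1 : L) else 0)).Local v)) → ∀ u u' : Fin (cQ T), u ≠ u' → finGammaTwo L v (σ T u s).1 ≠ finGammaTwo L v (σ T u' s).1) ∧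
      (∀ T ∈ SH, ∀ (s : ↥T), IsLocalGRegular L v (s : ((UnitaryGroup.cmDatum L 2 (Matrix.of fun i j : Fin 2 => if i.val + j.val + 1 = 2 then (1 : L) else 0)).Local v × (UnitaryGroup.cmDatum L 1 (Matrix.of fun i j : Fin 1 => if i.val + j.val + 1 = 1 then (1 : L) else 0)).Local v)) → ∀ r : UnitaryGroup.LocalRing L v,
      (((endoEmbLocal L v s.1).val.val : Matrix (Fin 3) (Fin 3) (UnitaryGroup.LocalRing L v)).charpoly).IsRoot r ↔ ∃ u : Fin (cQ T), finGammaTwo L v (σ T u s).1 = r) ∧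
      (∀ T ∈ SH, cQ T = 1 ∨ cQ T = 3) := by
  classical
  -- total choice: outside `SH` take no slots
  have hex : ∀ T : Subgroup ((UnitaryGroup.cmDatum L 2 (Matrix.of fun i j : Fin 2 => if i.val + j.val + 1 = 2 then (1 : L) else 0)).Local v × (UnitaryGroup.cmDatum L 1 (Matrix.of fun i j : Fin 1 => if i.val + j.val + 1 = 1 then (1 : L) else 0)).Local v), ∃ (k : ℕ) (e : Fin k → (↥T ≃ₜ* ↥T)), T ∈ SH → (k = 1 ∨ k = 3) ∧
      (∀ (u : Fin k) (s : ↥T), ((endoEmbLocal L v ((e u s : ↥T) : (UnitaryGroup.cmDatum L 2 (Matrix.of fun i j : Fin 2 => if i.val + j.val + 1 = 2 then (1 : L) else 0)).Local v × (UnitaryGroup.cmDatum L 1 (Matrix.of fun i j : Fin 1 => if i.val + j.val + 1 = 1 then (1 : L) else 0)).Local v)).val.val : Matrix (Fin 3) (Fin 3) (UnitaryGroup.LocalRing L v)).charpoly =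
        ((endoEmbLocal L v (s : (UnitaryGroup.cmDatum L 2 (Matrix.of fun i j : Fin 2 => if i.val + j.val + 1 = 2 then (1 : L) else 0)).Local v × (UnitaryGroup.cmDatum L 1 (Matrix.of fun i j : Fin 1 => if i.val + j.val + 1 = 1 then (1 : L) else 0)).Local v)).val.val : Matrix (Fin 3) (Fin 3) (UnitaryGroup.LocalRing L v)).charpoly) ∧
      (∀ s : ↥T, IsLocalGRegular L v (s : (UnitaryGroup.cmDatum L 2 (Matrix.of fun i j : Fin 2 => if i.val + j.val + 1 = 2 then (1 : L) else 0)).Local v × (UnitaryGroup.cmDatum L 1 (Matrix.of fun i j : Fin 1 => if i.val + j.val + 1 = 1 then (1 : L) else 0)).Local v) → ∀ u u' : Fin k, u ≠ u' → finGammaTwo L v ((e u s : ↥T) : (UnitaryGroup.cmDatum L 2 (Matrix.of fun i j : Fin 2 => if i.val + j.val + 1 = 2 then (1 : L) else 0)).Local v × (UnitaryGroup.cmDatum L 1 (Matrix.of fun i j : Fin 1 => if i.val + j.val + 1 = 1 then (1 : L) else 0)).Local v) ≠ finGammaTwo L v ((e u' s : ↥T) : (UnitaryGroup.cmDatum L 2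 (Matrix.of fun i j : Fin 2 => if i.val + j.val + 1 = 2 then (1 : L) else 0)).Local v × (UnitaryGroup.cmDatum L 1 (Matrix.of fun i j : Fin 1 => if i.val + j.val + 1 = 1 then (1 : L) else 0)).Local v)) ∧
      (∀ s : ↥T, IsLocalGRegular L v (s : (UnitaryGroup.cmDatum L 2 (Matrix.of fun i j : Fin 2 => if i.val + j.val + 1 = 2 then (1 : L) else 0)).Local v × (UnitaryGroup.cmDatum L 1 (Matrix.of fun i j : Fin 1 => if i.val + j.val + 1 = 1 then (1 : L) else 0)).Local v) → ∀ r : UnitaryGroup.LocalRing L v,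
        (((endoEmbLocal L v (s : (UnitaryGroup.cmDatum L 2 (Matrix.of fun i j : Fin 2 => if i.val + j.val + 1 = 2 then (1 : L) else 0)).Local v × (UnitaryGroup.cmDatum L 1 (Matrix.of fun i j : Fin 1 => if i.val + j.val + 1 = 1 then (1 : L) else 0)).Local v)).val.val : Matrix (Fin 3) (Fin 3) (UnitaryGroup.LocalRing L v)).charpoly).IsRoot r ↔ ∃ u : Fin k, finGammaTwo L v ((e u s : ↥T) : (UnitaryGroup.cmDatum L 2 (Matrix.of fun i j : Fin 2 => if i.val + j.val + 1 = 2 then (1 : L) else 0)).Local v × (UnitaryGroup.cmDatum L 1 (Matrix.of fun i j : Fin 1 => if i.val + j.val + 1 = 1 then (1 : L) else 0)).Local v) = r) := by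
    intro T
    by_cases hT : T ∈ SH
    · obtain ⟨γ₀, hγ₀, hTeq⟩ := hZ T hT
      obtain ⟨k, e, h0, h1, h2, h3⟩ := exists_slots hns hγ₀ hTeq (hKH T hT)
      exact ⟨k, e, fun _ => ⟨h0, h1, h2, h3⟩⟩
    · exact ⟨0, Fin.elim0, fun h => absurd h hT⟩
  choose k e hspec using hex
  refine ⟨k, fun T u => ⇑(e T u), fun T _ u => ⟨e T u, rfl⟩, ?_, fun T hT u s => (hspec T hT).2.1 u s, ?_, ?_, fun T hT => (hspec T hT).2.2.1,
    fun T hT => (hspec T hT).2.2.2, fun T hT => (hspec T hT).1⟩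
  · -- (M): Haar uniqueness on the closed subgroup `T`
    intro T hT u μ hμ hcore
    obtain ⟨γ₀, -, hTeq⟩ := hZ T hT
    have hTc : IsClosed (T : Set ((UnitaryGroup.cmDatum L 2 (Matrix.of fun i j : Fin 2 => if i.val + j.val + 1 = 2 then (1 : L) else 0)).Local v × (UnitaryGroup.cmDatum L 1 (Matrix.of fun i j : Fin 1 => if i.val + j.val + 1 = 1 then (1 : L) else 0)).Local v)) := F0P3cStCharTSUpTrCartanFields.isClosed_cartan hTeq
    haveI : LocallyCompactSpace ↥T := hTc.isClosedEmbedding_subtypeVal.locallyCompactSpace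
    haveI : SecondCountableTopology ↥T := TopologicalSpace.Subtype.secondCountableTopology _
    exact measurePreserving_of_continuousMulEquiv (e T u) μ hcore
  · -- (G): `G`-regularity is separability of `charpoly ι`, which is preserved
    intro T hT u s hs
    have key : ∀ x : (UnitaryGroup.cmDatum L 2 (Matrix.of fun i j : Fin 2 => if i.val + j.val + 1 = 2 then (1 : L) else 0)).Local v × (UnitaryGroup.cmDatum L 1 (Matrix.of fun i j : Fin 1 => if i.val + j.val + 1 = 1 then (1 : L) else 0)).Local v, IsLocalGRegular L v x ↔ IsRegularElt ((endoEmbLocal L v x).val : GL (Fin 3) (UnitaryGroup.LocalRing L v)) := fun _ => Iff.rfl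
    rw [key, isRegularElt_iff, (hspec T hT).2.1 u s]
    exact (key _).1 hs
  · -- (N′): same characteristic polynomial and regularity ⇒ same norm partners
    intro T hT u s hs γ hγ
    have hχ := (hspec T hT).2.1 u s
    have hγreg : IsRegularElt (γ.val : GL (Fin 3) (UnitaryGroup.LocalRing L v)) := hγ.isRegularElt L (qsForm L) v hs
    refine (F0P3cStCharTSFibreRealise.isLocalGRegular_and_isLocalNormPair_of_charpoly_eq L v _ γ hγreg ?_).2
    rw [hχ, charpoly_endoEmbLocal, ← hγ.charpoly_eq L (qsForm L) v]

end CM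

end Summit.HodgeConjecture.HodgeConjecture.Cruxes.H413.F0P3cStCharTSEllInnerSlotMaps

end
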